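import Summits.QuantumAdvantage.QuantumAdvantage.Theorems.LinnikCubicClassGroupsDegreeOnePrimesEscapeBinaryFormPNT
import Literature.NumberTheory.LFunctions.RHWave0PNTProofs
import HarnessLib

/-!
# Natural density of the primes represented by a positive definite binary quadratic form: `π_Q(x) ∼ δ_Q x/log x` and
# `π_Q(x)/π(x) → δ_Q` (de la Vallée Poussin 1897; Cox Thm. 9.12 in natural-density form), and the case `x² + ny²`

Topic `Summits/QuantumAdvantage/QuantumAdvantage/Theorems`, cell B2b-1 (linnik-cubic), PART A (gen 39); helper toward the crux
`DegreeOnePrimesEscape` (stmt-QuantumAdvantage-11543) of route `LinnikCubicClassGroups`.  HONEST FRAMING: the value of this file is a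
THEOREM (kernel-checked, unconditional) — NOT summit progress.

Corollaries of `tendsto_card_primesRepresented_div_offsetLogIntegral` (`π_Q(x)/Li(x) → δ_Q`, sibling file) with the tree's
`Li(x) ∼ x/log x` (`isEquivalent_offsetLogIntegral_holds`) and prime number theorem `π(x) ∼ x/log x` (`primeCounting_isEquivalent_holds`):
* `isEquivalent_card_primesRepresented` — **`π_Q(x) ∼ δ_Q · x/log x`**;
* `tendsto_card_primesRepresented_div_primeCounting` — **the primes represented by `Q` have NATURAL DENSITY `δ_Q`** among all primes,
  `δ_Q = 1/(2h(D))` if `Q ∼ (a, −b, c)` properly, `1/h(D)` otherwise;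
* `tendsto_card_prime_sq_add_mul_sq_div_primeCounting` — **the primes of the form `x² + ny²` have natural density `1/(2h(−4n))`**.

## References
* D. A. Cox, *Primes of the form x² + ny²*, 2nd ed., Wiley (2013), §9.B Thm. 9.12. [Cox2013]
* E. Landau, *Über Ideale und Primideale in Idealklassen*, Math. Z. 2 (1918) 52–154. [Landau1918Idealklassen]
-/

noncomputable section

open Real Set Filter Topology Asymptotics
open scoped NumberField

namespace Summit.QuantumAdvantage.QuantumAdvantage.Theorems.DegreeOnePrimesEscape

open Literature.NumberTheory.LFunctions Literature.NumberTheory.QuadraticFields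
open Literature.NumberTheory.QuadraticFields.Quadratic Literature.NumberTheory.QuadraticFields.Quadratic.BinQF
open Literature.Computability.Cryptography.Hallgren2005.OrderCl
open scoped Classical

/-- The density `δ_Q` is positive. -/
theorem density_pos {D : ℤ} (hD : D < 0) {Q : BinQF} (hQ : Q.IsPosPrim D) :
    0 < (if Q.ProperEquiv (negForm Q) then 1 / (2 * (BinaryQuadraticForm.classNumber D : ℝ))
        else 1 / (BinaryQuadraticForm.classNumber D : ℝ)) := by
  have hh : 0 < (BinaryQuadraticForm.classNumber D : ℝ) := by
    exact_mod_cast BinaryQuadraticForm.classNumber_pos hD hQ.emod_four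
  split_ifs <;> positivity

/-- **`π_Q(x) ∼ δ_Q · x / log x`** for a primitive positive definite form `Q` of discriminant `D < 0` (de la Vallée Poussin 1897;
Cox Thm. 9.12 in natural-density form). [cite: Cox2013, §9.B Thm. 9.12] -/
theorem isEquivalent_card_primesRepresented {D : ℤ} (hD : D < 0) {Q : BinQF} (hQ : Q.IsPosPrim D) :
    (fun x : ℝ ↦ (((((Finset.range (⌊x⌋₊ + 1)).filter Nat.Prime).filter
        (fun p : ℕ => ∃ a c : ℤ, Q.eval a c = (p : ℤ))).card : ℕ) : ℝ)) ~[atTop]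
      fun x : ℝ ↦ (if Q.ProperEquiv (negForm Q) then 1 / (2 * (BinaryQuadraticForm.classNumber D : ℝ))
        else 1 / (BinaryQuadraticForm.classNumber D : ℝ)) * (x / Real.log x) := by
  set δ : ℝ := (if Q.ProperEquiv (negForm Q) then 1 / (2 * (BinaryQuadraticForm.classNumber D : ℝ))
        else 1 / (BinaryQuadraticForm.classNumber D : ℝ)) with hδ
  have hδ0 : 0 < δ := density_pos hD hQ
  have hlim := tendsto_card_primesRepresented_div_offsetLogIntegral hD hQ
  have hLi : IsEquivalent atTop offsetLogIntegral fun x => x / Real.log x := isEquivalent_offsetLogIntegral_holds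
  -- `π_Q ∼ δ · Li`
  have h1 : IsEquivalent atTop (fun x : ℝ ↦ (((((Finset.range (⌊x⌋₊ + 1)).filter Nat.Prime).filter
        (fun p : ℕ => ∃ a c : ℤ, Q.eval a c = (p : ℤ))).card : ℕ) : ℝ)) fun x ↦ δ * offsetLogIntegral x := by
    refine isEquivalent_of_tendsto_one ?_
    have h := hlim.div_const δ
    rw [div_self hδ0.ne'] at h
    refine h.congr' (Eventually.of_forall fun x => ?_)
    simp only [Pi.div_apply]
    rw [div_div, mul_comm]
  have h2 : IsEquivalent atTop (fun x : ℝ ↦ δ * offsetLogIntegral x) fun x ↦ δ * (x / Real.log x) :=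
    (IsEquivalent.refl (u := fun _ : ℝ ↦ δ)).mul hLi
  exact h1.trans h2

/-- **The primes represented by `Q` have natural density `δ_Q` among the primes**: `π_Q(x)/π(x) → 1/(2h(D))` if `Q` is properly
equivalent to its opposite and `→ 1/h(D)` otherwise (prime number theorem `π(x) ∼ x/log x` from the tree). [cite: Cox2013, §9.B Thm. 9.12] -/
theorem tendsto_card_primesRepresented_div_primeCounting {D : ℤ} (hD : D < 0) {Q : BinQF} (hQ : Q.IsPosPrim D) :
    Tendsto (fun x : ℝ ↦ (((((Finset.range (⌊x⌋₊ + 1)).filter Nat.Prime).filter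
        (fun p : ℕ => ∃ a c : ℤ, Q.eval a c = (p : ℤ))).card : ℕ) : ℝ) / (Nat.primeCounting ⌊x⌋₊ : ℝ)) atTop
      (𝓝 (if Q.ProperEquiv (negForm Q) then 1 / (2 * (BinaryQuadraticForm.classNumber D : ℝ))
        else 1 / (BinaryQuadraticForm.classNumber D : ℝ))) := by
  set δ : ℝ := (if Q.ProperEquiv (negForm Q) then 1 / (2 * (BinaryQuadraticForm.classNumber D : ℝ))
        else 1 / (BinaryQuadraticForm.classNumber D : ℝ)) with hδ
  have hQδ := isEquivalent_card_primesRepresented hD hQ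
  have hπ : (fun x : ℝ ↦ (Nat.primeCounting ⌊x⌋₊ : ℝ)) ~[atTop] fun x ↦ x / Real.log x := primeCounting_isEquivalent_holds
  have hdiv := hQδ.div hπ
  refine (hdiv.congr_right ?_).tendsto_const
  filter_upwards [eventually_gt_atTop (1 : ℝ)] with x hx
  have hne : x / Real.log x ≠ 0 := div_ne_zero (by linarith) (Real.log_pos hx).ne'
  simp only [Pi.div_apply, Function.const_apply]
  rw [mul_div_assoc, div_self hne, mul_one]

/-- **The primes of the form `x² + ny²` (`n ≥ 1`) have natural density `1/(2h(−4n))`** (the principal form is its own opposite).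
[cite: Cox2013, §9.B Thm. 9.12] -/
theorem tendsto_card_prime_sq_add_mul_sq_div_primeCounting {n : ℕ} (hn : 0 < n) :
    Tendsto (fun x : ℝ ↦ (((((Finset.range (⌊x⌋₊ + 1)).filter Nat.Prime).filter
        (fun p : ℕ => ∃ a c : ℤ, a ^ 2 + n * c ^ 2 = (p : ℤ))).card : ℕ) : ℝ) / (Nat.primeCounting ⌊x⌋₊ : ℝ)) atTop
      (𝓝 (1 / (2 * (BinaryQuadraticForm.classNumber (-4 * (n : ℤ)) : ℝ)))) := by
  have hQ := isPosPrim_sq_add_mul_sq n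
  have h := tendsto_card_primesRepresented_div_primeCounting (by omega : -4 * (n : ℤ) < 0) hQ
  have hself : (⟨1, 0, n⟩ : BinQF).ProperEquiv (negForm ⟨1, 0, n⟩) := by
    have : negForm (⟨1, 0, n⟩ : BinQF) = ⟨1, 0, n⟩ := by simp [negForm]
    rw [this]
    exact BinQF.ProperEquiv.refl _
  rw [if_pos hself] at h
  refine h.congr' (Eventually.of_forall fun x => ?_)
  congr 3
  refine Finset.filter_congr fun p _ => ?_
  simp [BinQF.eval]

/-! ### Numerical instances (appended): `x² + y²`, `x² + 2y²`, `x² + 3y²`, `x² + 5y²` -/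

/-- The density `1/(2h(−4n))` with `h(−4n)` evaluated through the computable form count `Quadratic.BinQF.classNumber`.
[cite: Cox2013, §9.B Thm. 9.12] -/
theorem tendsto_card_prime_sq_add_mul_sq_div_primeCounting_of_classNumber {n h : ℕ} (hn : 0 < n)
    (hh : Quadratic.BinQF.classNumber (-4 * (n : ℤ)) = h) :
    Tendsto (fun x : ℝ ↦ (((((Finset.range (⌊x⌋₊ + 1)).filter Nat.Prime).filter
        (fun p : ℕ => ∃ a c : ℤ, a ^ 2 + n * c ^ 2 = (p : ℤ))).card : ℕ) : ℝ) / (Nat.primeCounting ⌊x⌋₊ : ℝ)) atTop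
      (𝓝 (1 / (2 * (h : ℝ)))) := by
  have hcl : BinaryQuadraticForm.classNumber (-4 * (n : ℤ)) = h := by
    rw [← BinaryQuadraticForm.binQF_classNumber_eq _ (by omega), hh]
  have := tendsto_card_prime_sq_add_mul_sq_div_primeCounting hn
  rwa [hcl] at this

/-- **The primes `p = a² + b²` have natural density `1/2`** (`h(−4) = 1`; by Fermat these are `2` and the primes `≡ 1 (mod 4)`).
[cite: Cox2013, §9.B Thm. 9.12] -/
theorem tendsto_card_prime_sq_add_sq_div_primeCounting :
    Tendsto (fun x : ℝ ↦ (((((Finset.range (⌊x⌋₊ + 1)).filter Nat.Prime).filter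
        (fun p : ℕ => ∃ a c : ℤ, a ^ 2 + c ^ 2 = (p : ℤ))).card : ℕ) : ℝ) / (Nat.primeCounting ⌊x⌋₊ : ℝ)) atTop
      (𝓝 (1 / 2)) := by
  have h := tendsto_card_prime_sq_add_mul_sq_div_primeCounting_of_classNumber (n := 1) (h := 1) one_pos (by decide)
  simp only [Nat.cast_one, mul_one, one_mul] at h
  exact h

/-- **The primes `p = a² + 2b²` have natural density `1/2`** (`h(−8) = 1`). [cite: Cox2013, §9.B Thm. 9.12] -/
theorem tendsto_card_prime_sq_add_two_mul_sq_div_primeCounting :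
    Tendsto (fun x : ℝ ↦ (((((Finset.range (⌊x⌋₊ + 1)).filter Nat.Prime).filter
        (fun p : ℕ => ∃ a c : ℤ, a ^ 2 + 2 * c ^ 2 = (p : ℤ))).card : ℕ) : ℝ) / (Nat.primeCounting ⌊x⌋₊ : ℝ)) atTop
      (𝓝 (1 / 2)) := by
  have h := tendsto_card_prime_sq_add_mul_sq_div_primeCounting_of_classNumber (n := 2) (h := 1) two_pos (by decide)
  simp only [Nat.cast_one, mul_one, Nat.cast_ofNat] at h
  exact h

/-- **The primes `p = a² + 3b²` have natural density `1/2`** (`h(−12) = 1`). [cite: Cox2013, §9.B Thm. 9.12] -/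
theorem tendsto_card_prime_sq_add_three_mul_sq_div_primeCounting :
    Tendsto (fun x : ℝ ↦ (((((Finset.range (⌊x⌋₊ + 1)).filter Nat.Prime).filter
        (fun p : ℕ => ∃ a c : ℤ, a ^ 2 + 3 * c ^ 2 = (p : ℤ))).card : ℕ) : ℝ) / (Nat.primeCounting ⌊x⌋₊ : ℝ)) atTop
      (𝓝 (1 / 2)) := by
  have h := tendsto_card_prime_sq_add_mul_sq_div_primeCounting_of_classNumber (n := 3) (h := 1) (by norm_num) (by decide)
  simp only [Nat.cast_one, mul_one, Nat.cast_ofNat] at h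
  exact h

/-- **The primes `p = a² + 5b²` have natural density `1/4`** (`h(−20) = 2`: Euler's `p ≡ 1, 9 (mod 20)`). [cite: Cox2013, §9.B Thm. 9.12] -/
theorem tendsto_card_prime_sq_add_five_mul_sq_div_primeCounting :
    Tendsto (fun x : ℝ ↦ (((((Finset.range (⌊x⌋₊ + 1)).filter Nat.Prime).filter
        (fun p : ℕ => ∃ a c : ℤ, a ^ 2 + 5 * c ^ 2 = (p : ℤ))).card : ℕ) : ℝ) / (Nat.primeCounting ⌊x⌋₊ : ℝ)) atTop
      (𝓝 (1 / 4)) := by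
  have h := tendsto_card_prime_sq_add_mul_sq_div_primeCounting_of_classNumber (n := 5) (h := 2) (by norm_num) (by decide)
  norm_num at h
  exact h

end Summit.QuantumAdvantage.QuantumAdvantage.Theorems.DegreeOnePrimesEscape

end
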